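import Summits.CriticalPhenomena.PercolationContinuityZ3.Theorems.Transplant.SkelSeedSlabDeep
import HarnessLib

/-!
# L5.5b v3, part 2 — the deep slab geometry of a window level and its kit hypotheses (`slabGeomDeep`, `NearFaceOKDeep`,
# `kitOK_slabDeep`); coordinates of the path and of the slab cylinder (companion of `SkelSeedSlabDeep`, see its docstring)

builds on p205010 (kernel theorem, internal audit signed; external expert review pending) — nothing in this file uses p205010.
Lane `prim-bschramm`, seat `prim-bschramm-p1` (gen 7); helper file (`--supports stmt-CriticalPhenomena-4575 --as helper`); namespace
`Transplant.SkelI`, `[DecidableEq V]` binder.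
* §1 coordinates: `pathLen_le`, `φ_pathPt_exit`, `φ_pathPt_tan`, `φ_cyl_deepCtr`, `pathPt_last_mem_cylBall`;
* §2 `slabGeomDeep`, `NearFaceOKDeep`, **`kitOK_slabDeep`**.
[cite: KozmaNitzan2024, §4 Lemma 10, p. 19 (Step III), p. 21 (v(P) + Λ_M, U(P))] [cite: GrimmettPercolation1999, §7.2]
-/

noncomputable section

open scoped Classical

namespace Summit.CriticalPhenomena.PercolationContinuityZ3.Theorems

namespace Transplant

namespace SkelI

open Literature.Probability.Percolation Literature.Probability.LatticeModels SimpleGraph KNLevels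
open Literature.Probability.Percolation.KozmaNitzan.Cells (oth oth_ne eq_oth_of_ne oth_oth)
open Literature.Barriers.CriticalPhenomena (graphBall graphBall_finite mem_graphBall_self graphBall_mono)
open BoxProdZ2 (ballFin mem_ballFin card_ballFin_le)
open Skel (winGraph winGraph_adj winLevel mem_winLevel_iff winLevel_monotone winLevel_subset_graphBall winLData winLData_X inNbr KitGeom
  cylBallFin mem_cylBallFin pathIn_cylBall' cylBall_subset_cyl)

variable {V : Type} [DecidableEq V] {G : SimpleGraph V} [G.LocallyFinite] (Φ : PlanarSkeletonConc G)

/-! ## §1 Coordinates of the path and of the slab cylinder -/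

omit [DecidableEq V] in
/-- The path has at most `T₀` tangential steps. [folklore] -/
theorem pathLen_le {Lo Hi : Site 2} {ℓs M : ℕ} (i₀ : Fin 2) (hw : Lo (oth i₀) + 2 * tanOff ℓs M ≤ Hi (oth i₀)) {y : V}
    (hy : Φ.φ y ∈ Finset.Icc Lo Hi) : pathLen Φ Lo Hi ℓs M i₀ y ≤ tanOff ℓs M := by
  rw [Finset.mem_Icc] at hy
  exact natAbs_tanTgt_sub_le (oth i₀) hw (hy.1 _) (hy.2 _)

/-- The exit coordinate along the path of a contact: `φ p_k i₀ = φ y i₀ − σ` (one unit off the exit face). [folklore] -/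
theorem φ_pathPt_exit {w₀ : V} {R : ℕ} {Lo Hi : Site 2} {ℓs M : ℕ} (hw2 : ∀ i, Lo i + 2 ≤ Hi i) {x : V}
    (hx : x ∈ outerBoundary (winGraph G w₀ R) (Φ.Win w₀ (Finset.Icc Lo Hi) R)) (k : ℕ) :
    Φ.φ (pathPt Φ Lo Hi ℓs M (exitDir Φ w₀ R Lo Hi x).1 (inNbr Φ w₀ R (Finset.Icc Lo Hi) x) k) (exitDir Φ w₀ R Lo Hi x).1 =
      Φ.φ (inNbr Φ w₀ R (Finset.Icc Lo Hi) x) (exitDir Φ w₀ R Lo Hi x).1 - ((exitDir Φ w₀ R Lo Hi x).2 : ℤ) := by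
  obtain ⟨-, -, hyP⟩ := inNbr_spec Φ hx
  rw [(φ_pathPt Φ _ (hw2 _) hyP k).1]
  have hw := hw2 (exitDir Φ w₀ R Lo Hi x).1
  rcases exitDir_spec Φ hx with ⟨hs, hc⟩ | ⟨hs, hc⟩ <;> rw [hs, hc] <;>
    simp only [slabPt, max_def, min_def, Nat.cast_one, Units.val_one, Units.val_neg] <;> split_ifs <;> omega

omit [DecidableEq V] in
/-- The tangential coordinate along the path (`k ≤ K`): inside `[Lo i₁, Hi i₁]`, and in the interior `[Lo i₁ + 1, Hi i₁ − 1]` from the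
first tangential step on. [folklore] -/
theorem φ_pathPt_tan {Lo Hi : Site 2} {ℓs M : ℕ} (i₀ : Fin 2) (hw2 : Lo i₀ + 2 ≤ Hi i₀) (hw : Lo (oth i₀) + 2 * tanOff ℓs M ≤ Hi (oth i₀))
    {y : V} (hy : Φ.φ y ∈ Finset.Icc Lo Hi) {k : ℕ} (hk : k ≤ pathLen Φ Lo Hi ℓs M i₀ y) :
    Lo (oth i₀) ≤ Φ.φ (pathPt Φ Lo Hi ℓs M i₀ y k) (oth i₀) ∧ Φ.φ (pathPt Φ Lo Hi ℓs M i₀ y k) (oth i₀) ≤ Hi (oth i₀) ∧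
      (1 ≤ k → Lo (oth i₀) + 1 ≤ Φ.φ (pathPt Φ Lo Hi ℓs M i₀ y k) (oth i₀) ∧ Φ.φ (pathPt Φ Lo Hi ℓs M i₀ y k) (oth i₀) ≤ Hi (oth i₀) - 1) := by
  rw [(φ_pathPt Φ i₀ hw2 hy k).2]
  have hτ := tanTgt_mem (oth i₀) hw (Φ.φ y)
  have hyb := hy; rw [Finset.mem_Icc] at hyb
  have h1 : Lo (oth i₀) ≤ Φ.φ y (oth i₀) := hyb.1 _
  have h2 : Φ.φ y (oth i₀) ≤ Hi (oth i₀) := hyb.2 _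
  have hT : 1 ≤ tanOff ℓs M := by unfold tanOff; omega
  unfold pathLen at hk
  set d := tanTgt Lo Hi ℓs M (oth i₀) (Φ.φ y) - Φ.φ y (oth i₀) with hd
  unfold tanSign
  by_cases hd0 : 0 ≤ d
  · rw [if_pos hd0, Units.val_one, mul_one]
    have hk' : (k : ℤ) ≤ d := by have := Int.natAbs_of_nonneg hd0; omega
    refine ⟨by omega, by omega, fun hk1 => ⟨by omega, by omega⟩⟩
  · rw [if_neg hd0, Units.val_neg, Units.val_one, mul_neg, mul_one]
    have hk' : (k : ℤ) ≤ -d := by have := Int.ofNat_natAbs_of_nonpos (le_of_lt (not_le.1 hd0)); omega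
    refine ⟨by omega, by omega, fun hk1 => ⟨by omega, by omega⟩⟩

/-- Coordinates of the slab cylinder about the deep centre: interior in every coordinate, exit-depth `≤ 2ℓs + 1`, tangential depth
`≥ T₀ − ℓs`. [folklore] -/
theorem φ_cyl_deepCtr {w₀ : V} {R : ℕ} {Lo Hi : Site 2} {ℓs M : ℕ} (hw : ∀ i, Lo i + 2 * tanOff ℓs M ≤ Hi i) {x : V}
    (hx : x ∈ outerBoundary (winGraph G w₀ R) (Φ.Win w₀ (Finset.Icc Lo Hi) R)) {v : V}
    (hv : v ∈ Φ.toPlanarSkeleton.cyl (deepCtr Φ w₀ R Lo Hi ℓs M x) ℓs) :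
    (∀ i, Lo i + 1 ≤ Φ.φ v i ∧ Φ.φ v i ≤ Hi i - 1) ∧
      (Φ.φ v (exitDir Φ w₀ R Lo Hi x).1 ≤ Lo (exitDir Φ w₀ R Lo Hi x).1 + (2 * ℓs + 1) ∨
        Hi (exitDir Φ w₀ R Lo Hi x).1 - (2 * ℓs + 1) ≤ Φ.φ v (exitDir Φ w₀ R Lo Hi x).1) ∧
      (Lo (oth (exitDir Φ w₀ R Lo Hi x).1) + (tanOff ℓs M - ℓs : ℕ) ≤ Φ.φ v (oth (exitDir Φ w₀ R Lo Hi x).1) ∧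
        Φ.φ v (oth (exitDir Φ w₀ R Lo Hi x).1) ≤ Hi (oth (exitDir Φ w₀ R Lo Hi x).1) - (tanOff ℓs M - ℓs : ℕ)) := by
  obtain ⟨-, -, hyP⟩ := inNbr_spec Φ hx
  rw [PlanarSkeleton.mem_cyl, mem_box] at hv
  have hex := hv (exitDir Φ w₀ R Lo Hi x).1
  have htan := hv (oth (exitDir Φ w₀ R Lo Hi x).1)
  rw [Pi.sub_apply, φ_deepCtr_exit Φ hw hyP] at hex
  rw [Pi.sub_apply, φ_deepCtr_tan Φ hw hyP] at htan
  have hτ := tanTgt_mem (oth (exitDir Φ w₀ R Lo Hi x).1) (hw (oth (exitDir Φ w₀ R Lo Hi x).1)) (Φ.φ (inNbr Φ w₀ R (Finset.Icc Lo Hi) x))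
  have hT : tanOff ℓs M = 2 * ℓs + 2 + M := rfl
  have hwi := hw (exitDir Φ w₀ R Lo Hi x).1
  rw [hT] at hwi hτ
  push_cast at hwi hτ
  have hTl : ((tanOff ℓs M - ℓs : ℕ) : ℤ) = ℓs + 2 + M := by rw [hT, Nat.cast_sub (by omega)]; push_cast; ring
  -- the exit coordinate, by the sign
  have hexit : (Lo (exitDir Φ w₀ R Lo Hi x).1 + 1 ≤ Φ.φ v (exitDir Φ w₀ R Lo Hi x).1 ∧
      Φ.φ v (exitDir Φ w₀ R Lo Hi x).1 ≤ Hi (exitDir Φ w₀ R Lo Hi x).1 - 1) ∧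
      (Φ.φ v (exitDir Φ w₀ R Lo Hi x).1 ≤ Lo (exitDir Φ w₀ R Lo Hi x).1 + (2 * ℓs + 1) ∨
        Hi (exitDir Φ w₀ R Lo Hi x).1 - (2 * ℓs + 1) ≤ Φ.φ v (exitDir Φ w₀ R Lo Hi x).1) := by
    rcases exitDir_spec Φ hx with ⟨hs, hc⟩ | ⟨hs, hc⟩
    · rw [hs, hc, Units.val_one, one_mul] at hex
      exact ⟨⟨by omega, by omega⟩, Or.inr (by omega)⟩
    · rw [hs, hc, Units.val_neg, Units.val_one, neg_mul, one_mul] at hex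
      exact ⟨⟨by omega, by omega⟩, Or.inl (by omega)⟩
  refine ⟨fun i => ?_, hexit.2, ?_⟩
  · by_cases hi : i = (exitDir Φ w₀ R Lo Hi x).1
    · rw [hi]; exact hexit.1
    · rw [eq_oth_of_ne hi]; constructor <;> omega
  · rw [hTl]; constructor <;> omega

/-- **The last path vertex lies in the slab's cylinder ball**, for `R′` with `B_G(c, ℓs + 2 + 2T₀) ∩ cyl c ℓs ⊆ cylBall c ℓs R′`.
[folklore] -/
theorem pathPt_last_mem_cylBall {w₀ : V} {R : ℕ} {Lo Hi : Site 2} {ℓs M R' : ℕ} (hw : ∀ i, Lo i + 2 * tanOff ℓs M ≤ Hi i)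
    (hR' : ∀ c : V, graphBall G c (ℓs + 2 + 2 * tanOff ℓs M) ∩ Φ.toPlanarSkeleton.cyl c ℓs ⊆ Φ.cylBall c ℓs R') {x : V}
    (hx : x ∈ outerBoundary (winGraph G w₀ R) (Φ.Win w₀ (Finset.Icc Lo Hi) R)) :
    pathPt Φ Lo Hi ℓs M (exitDir Φ w₀ R Lo Hi x).1 (inNbr Φ w₀ R (Finset.Icc Lo Hi) x)
        (pathLen Φ Lo Hi ℓs M (exitDir Φ w₀ R Lo Hi x).1 (inNbr Φ w₀ R (Finset.Icc Lo Hi) x)) ∈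
      Φ.cylBall (deepCtr Φ w₀ R Lo Hi ℓs M x) ℓs R' := by
  obtain ⟨-, -, hyP⟩ := inNbr_spec Φ hx
  have hw2 : ∀ i, Lo i + 2 ≤ Hi i := fun i => by have := hw i; unfold tanOff at this; omega
  refine hR' _ ⟨?_, ?_⟩
  · have h1 := (deepCtr_spec Φ hw hyP).1
    have h2 := pathPt_mem_graphBall Φ (ℓs := ℓs) (M := M) (exitDir Φ w₀ R Lo Hi x).1 (hw2 _) hyP
      (pathLen Φ Lo Hi ℓs M (exitDir Φ w₀ R Lo Hi x).1 (inNbr Φ w₀ R (Finset.Icc Lo Hi) x))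
    have h3 := BoxProdZ2.mem_graphBall_add G ((BoxProdZ2.mem_graphBall_comm G).1 h1) h2
    have hK := pathLen_le Φ (ℓs := ℓs) (M := M) (exitDir Φ w₀ R Lo Hi x).1 (hw (oth _)) hyP
    exact graphBall_mono G _ (by omega) h3
  · rw [PlanarSkeleton.mem_cyl, mem_box]
    intro i
    rw [Pi.sub_apply]
    by_cases hi : i = (exitDir Φ w₀ R Lo Hi x).1
    · rw [hi, φ_pathPt_exit Φ hw2 hx, φ_deepCtr_exit Φ hw hyP]
      rcases Int.units_eq_one_or (exitDir Φ w₀ R Lo Hi x).2 with h | h <;> rw [h] <;> push_cast <;> constructor <;> nlinarith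
    · rw [eq_oth_of_ne hi, φ_pathPt_last Φ _ (hw2 _) hyP, φ_deepCtr_tan Φ hw hyP, sub_self]
      constructor
      · have : (0 : ℤ) ≤ ℓs := Nat.cast_nonneg ℓs
        linarith
      · exact Nat.cast_nonneg ℓs

/-! ## §2 The deep slab geometry and the kit hypotheses -/

/-- **The deep slab geometry** of the window level `j` (`Lo = lo − j`, `Hi = hi + j`): `y = inNbr`; NEAR contact (`y ∈ B_G(w₀, R − r₀)`):
region `{y} ∪ {p₀, …, p_K} ∪ cylBallFin (deepCtr x) ℓs R′`, face `Unear x`; FAR contact: region and face `{y}`.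
[cite: KozmaNitzan2024, §4 p. 19 (seeds), p. 21 (v(P))] -/
def slabGeomDeep (w₀ : V) (R : ℕ) (lo hi : Site 2) (j ℓs M R' r₀ : ℕ) (Unear : V → Finset V) : KitGeom V where
  y := inNbr Φ w₀ R (Finset.Icc (lo - (j : Site 2)) (hi + (j : Site 2)))
  S := fun x =>
    if inNbr Φ w₀ R (Finset.Icc (lo - (j : Site 2)) (hi + (j : Site 2))) x ∈ graphBall G w₀ (R - r₀) then
      insert (inNbr Φ w₀ R (Finset.Icc (lo - (j : Site 2)) (hi + (j : Site 2))) x) (pathFin Φ (lo - (j : Site 2)) (hi + (j : Site 2)) ℓs M (exitDir Φ w₀ R (lo - (j : Site 2)) (hi + (j : Site 2)) x).1 (inNbr Φ w₀ R (Finset.Icc (lo - (j : Site 2)) (hi + (j : Site 2))) x)) ∪ cylBallFin Φ (deepCtr Φ w₀ R (lo - (j : Site 2)) (hi + (j : Site 2)) ℓs M x) ℓs R'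
    else {inNbr Φ w₀ R (Finset.Icc (lo - (j : Site 2)) (hi + (j : Site 2))) x}
  U := fun x => if inNbr Φ w₀ R (Finset.Icc (lo - (j : Site 2)) (hi + (j : Site 2))) x ∈ graphBall G w₀ (R - r₀) then Unear x else {inNbr Φ w₀ R (Finset.Icc (lo - (j : Site 2)) (hi + (j : Site 2))) x}

/-- **The face conditions of a near contact, deep slab**: the face lies in `B⟨j⟩` and in `B_G(x, rs)`, each face vertex has a
`G`-neighbour in the cylinder ball `cylBall (deepCtr x) ℓs R′`, at most `cU` vertices. [cite: KozmaNitzan2024, §4 p. 21 (U(P))] -/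
structure NearFaceOKDeep (w₀ : V) (R : ℕ) (lo hi : Site 2) (j ℓs M R' r₀ rs cU : ℕ) (Unear : V → Finset V) : Prop where
  sub : ∀ x ∈ outerBoundary (winGraph G w₀ R) (winLevel Φ w₀ R lo hi j), inNbr Φ w₀ R (Finset.Icc (lo - (j : Site 2)) (hi + (j : Site 2))) x ∈ graphBall G w₀ (R - r₀) → Unear x ⊆ winLevel Φ w₀ R lo hi j
  ball : ∀ x ∈ outerBoundary (winGraph G w₀ R) (winLevel Φ w₀ R lo hi j), inNbr Φ w₀ R (Finset.Icc (lo - (j : Site 2)) (hi + (j : Site 2))) x ∈ graphBall G w₀ (R - r₀) → ∀ u ∈ Unear x, u ∈ graphBall G x rs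
  adj : ∀ x ∈ outerBoundary (winGraph G w₀ R) (winLevel Φ w₀ R lo hi j), inNbr Φ w₀ R (Finset.Icc (lo - (j : Site 2)) (hi + (j : Site 2))) x ∈ graphBall G w₀ (R - r₀) → ∀ u ∈ Unear x,
    ∃ v ∈ Φ.cylBall (deepCtr Φ w₀ R (lo - (j : Site 2)) (hi + (j : Site 2)) ℓs M x) ℓs R', G.Adj v u
  card : ∀ x ∈ outerBoundary (winGraph G w₀ R) (winLevel Φ w₀ R lo hi j), inNbr Φ w₀ R (Finset.Icc (lo - (j : Site 2)) (hi + (j : Site 2))) x ∈ graphBall G w₀ (R - r₀) → (Unear x).card ≤ cU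
  one_le : 1 ≤ cU

/-- **The deep slab geometry satisfies `KitOK`** with region size `(Δ+1)^{R′} + (T₀ + 2)` and reach `rs`, provided every side of the box
is `≥ 2T₀`, `B_G(c, ℓs+2+2T₀) ∩ cyl c ℓs ⊆ cylBall c ℓs R′` at every centre, `ℓs + 1 + T₀ + R′ ≤ r₀ ≤ R`, `ℓs + 2 + T₀ + R′ ≤ rs`, and the
near faces satisfy `NearFaceOKDeep`. [cite: KozmaNitzan2024, §4 p. 19 (Step III)] -/
theorem kitOK_slabDeep {w₀ : V} {R : ℕ} {lo hi : Site 2} {j ℓs M R' r₀ rs cU : ℕ} {Unear : V → Finset V}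
    (hwide : ∀ i, (lo - (j : Site 2)) i + 2 * tanOff ℓs M ≤ (hi + (j : Site 2)) i)
    (hR' : ∀ c : V, graphBall G c (ℓs + 2 + 2 * tanOff ℓs M) ∩ Φ.toPlanarSkeleton.cyl c ℓs ⊆ Φ.cylBall c ℓs R')
    (hr₀ : ℓs + 1 + tanOff ℓs M + R' ≤ r₀) (hR : r₀ ≤ R) (hrs : ℓs + 2 + tanOff ℓs M + R' ≤ rs)
    (hU : NearFaceOKDeep Φ w₀ R lo hi j ℓs M R' r₀ rs cU Unear) :
    KitOK Φ w₀ R lo hi j rs ((Φ.Δ + 1) ^ R' + (tanOff ℓs M + 2)) cU (slabGeomDeep Φ w₀ R lo hi j ℓs M R' r₀ Unear) := by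
  set K := outerBoundary (winGraph G w₀ R) (winLevel Φ w₀ R lo hi j) with hK
  have hKeq : winLevel Φ w₀ R lo hi j = Φ.Win w₀ (Finset.Icc (lo - (j : Site 2)) (hi + (j : Site 2))) R := rfl
  have hx' : ∀ x ∈ K, x ∈ outerBoundary (winGraph G w₀ R) (Φ.Win w₀ (Finset.Icc (lo - (j : Site 2)) (hi + (j : Site 2))) R) := fun x hx => by rwa [hK, hKeq] at hx
  have hw2 : ∀ i, (lo - (j : Site 2)) i + 2 ≤ (hi + (j : Site 2)) i := fun i => by have := hwide i; unfold tanOff at this; omega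
  -- the inner neighbour
  have hy : ∀ x ∈ K, G.Adj x (inNbr Φ w₀ R (Finset.Icc (lo - (j : Site 2)) (hi + (j : Site 2))) x) ∧ inNbr Φ w₀ R (Finset.Icc (lo - (j : Site 2)) (hi + (j : Site 2))) x ∈ graphBall G w₀ R ∧ Φ.φ (inNbr Φ w₀ R (Finset.Icc (lo - (j : Site 2)) (hi + (j : Site 2))) x) ∈ Finset.Icc (lo - (j : Site 2)) (hi + (j : Site 2)) := fun x hx => inNbr_spec Φ (hx' x hx)
  -- path vertices: in the box, near `y`
  have hKle : ∀ x ∈ K, pathLen Φ (lo - (j : Site 2)) (hi + (j : Site 2)) ℓs M (exitDir Φ w₀ R (lo - (j : Site 2)) (hi + (j : Site 2)) x).1 (inNbr Φ w₀ R (Finset.Icc (lo - (j : Site 2)) (hi + (j : Site 2))) x) ≤ tanOff ℓs M :=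
    fun x hx => pathLen_le Φ _ (hwide _) (hy x hx).2.2
  have hpbox : ∀ x ∈ K, ∀ k, k ≤ pathLen Φ (lo - (j : Site 2)) (hi + (j : Site 2)) ℓs M (exitDir Φ w₀ R (lo - (j : Site 2)) (hi + (j : Site 2)) x).1 (inNbr Φ w₀ R (Finset.Icc (lo - (j : Site 2)) (hi + (j : Site 2))) x) →
      Φ.φ (pathPt Φ (lo - (j : Site 2)) (hi + (j : Site 2)) ℓs M (exitDir Φ w₀ R (lo - (j : Site 2)) (hi + (j : Site 2)) x).1 (inNbr Φ w₀ R (Finset.Icc (lo - (j : Site 2)) (hi + (j : Site 2))) x) k) ∈ Finset.Icc (lo - (j : Site 2)) (hi + (j : Site 2)) := by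
    intro x hx k hk
    have hex := (φ_pathPt Φ (ℓs := ℓs) (M := M) (exitDir Φ w₀ R (lo - (j : Site 2)) (hi + (j : Site 2)) x).1 (hw2 _) (hy x hx).2.2 k).1
    have htan := φ_pathPt_tan Φ (exitDir Φ w₀ R (lo - (j : Site 2)) (hi + (j : Site 2)) x).1 (hw2 _) (hwide _) (hy x hx).2.2 hk
    rw [Finset.mem_Icc]
    have hsl : (lo - (j : Site 2)) (exitDir Φ w₀ R (lo - (j : Site 2)) (hi + (j : Site 2)) x).1 + 1 ≤ slabPt (lo - (j : Site 2)) (hi + (j : Site 2)) 1 (Φ.φ (inNbr Φ w₀ R (Finset.Icc (lo - (j : Site 2)) (hi + (j : Site 2))) x)) (exitDir Φ w₀ R (lo - (j : Site 2)) (hi + (j : Site 2)) x).1 ∧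
        slabPt (lo - (j : Site 2)) (hi + (j : Site 2)) 1 (Φ.φ (inNbr Φ w₀ R (Finset.Icc (lo - (j : Site 2)) (hi + (j : Site 2))) x)) (exitDir Φ w₀ R (lo - (j : Site 2)) (hi + (j : Site 2)) x).1 ≤ (hi + (j : Site 2)) (exitDir Φ w₀ R (lo - (j : Site 2)) (hi + (j : Site 2)) x).1 - 1 := by
      have := hw2 (exitDir Φ w₀ R (lo - (j : Site 2)) (hi + (j : Site 2)) x).1
      simp only [slabPt, max_def, min_def, Nat.cast_one]; split_ifs <;> constructor <;> omega
    constructor <;> intro i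
    · by_cases hi0 : i = (exitDir Φ w₀ R (lo - (j : Site 2)) (hi + (j : Site 2)) x).1
      · rw [hi0, hex]; exact (hsl.1).trans' (by omega)
      · rw [eq_oth_of_ne hi0]; exact htan.1
    · by_cases hi0 : i = (exitDir Φ w₀ R (lo - (j : Site 2)) (hi + (j : Site 2)) x).1
      · rw [hi0, hex]; exact hsl.2.trans (by omega)
      · rw [eq_oth_of_ne hi0]; exact htan.2.1
  have hpball : ∀ x ∈ K, ∀ k, pathPt Φ (lo - (j : Site 2)) (hi + (j : Site 2)) ℓs M (exitDir Φ w₀ R (lo - (j : Site 2)) (hi + (j : Site 2)) x).1 (inNbr Φ w₀ R (Finset.Icc (lo - (j : Site 2)) (hi + (j : Site 2))) x) k ∈ graphBall G (inNbr Φ w₀ R (Finset.Icc (lo - (j : Site 2)) (hi + (j : Site 2))) x) (k + 1) :=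
    fun x hx k => pathPt_mem_graphBall Φ _ (hw2 _) (hy x hx).2.2 k
  have hmem_pathFin : ∀ x ∈ K, ∀ v ∈ pathFin Φ (lo - (j : Site 2)) (hi + (j : Site 2)) ℓs M (exitDir Φ w₀ R (lo - (j : Site 2)) (hi + (j : Site 2)) x).1 (inNbr Φ w₀ R (Finset.Icc (lo - (j : Site 2)) (hi + (j : Site 2))) x),
      ∃ k, k ≤ pathLen Φ (lo - (j : Site 2)) (hi + (j : Site 2)) ℓs M (exitDir Φ w₀ R (lo - (j : Site 2)) (hi + (j : Site 2)) x).1 (inNbr Φ w₀ R (Finset.Icc (lo - (j : Site 2)) (hi + (j : Site 2))) x) ∧ pathPt Φ (lo - (j : Site 2)) (hi + (j : Site 2)) ℓs M (exitDir Φ w₀ R (lo - (j : Site 2)) (hi + (j : Site 2)) x).1 (inNbr Φ w₀ R (Finset.Icc (lo - (j : Site 2)) (hi + (j : Site 2))) x) k = v := by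
    intro x hx v hv
    unfold pathFin at hv
    rw [Finset.mem_image] at hv
    obtain ⟨k, hk, rfl⟩ := hv
    exact ⟨k, by rw [Finset.mem_range] at hk; omega, rfl⟩
  have hpathFin_mem : ∀ x ∈ K, ∀ k, k ≤ pathLen Φ (lo - (j : Site 2)) (hi + (j : Site 2)) ℓs M (exitDir Φ w₀ R (lo - (j : Site 2)) (hi + (j : Site 2)) x).1 (inNbr Φ w₀ R (Finset.Icc (lo - (j : Site 2)) (hi + (j : Site 2))) x) →
      pathPt Φ (lo - (j : Site 2)) (hi + (j : Site 2)) ℓs M (exitDir Φ w₀ R (lo - (j : Site 2)) (hi + (j : Site 2)) x).1 (inNbr Φ w₀ R (Finset.Icc (lo - (j : Site 2)) (hi + (j : Site 2))) x) k ∈ pathFin Φ (lo - (j : Site 2)) (hi + (j : Site 2)) ℓs M (exitDir Φ w₀ R (lo - (j : Site 2)) (hi + (j : Site 2)) x).1 (inNbr Φ w₀ R (Finset.Icc (lo - (j : Site 2)) (hi + (j : Site 2))) x) := by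
    intro x hx k hk
    unfold pathFin
    exact Finset.mem_image_of_mem _ (Finset.mem_range.2 (by omega))
  -- the deep centre and its cylinder ball
  have ht : ∀ x ∈ K, deepCtr Φ w₀ R (lo - (j : Site 2)) (hi + (j : Site 2)) ℓs M x ∈ graphBall G (inNbr Φ w₀ R (Finset.Icc (lo - (j : Site 2)) (hi + (j : Site 2))) x) (ℓs + 1 + tanOff ℓs M) :=
    fun x hx => (deepCtr_spec Φ hwide (hy x hx).2.2).1
  have hcyl_box : ∀ x ∈ K, ∀ v ∈ Φ.cylBall (deepCtr Φ w₀ R (lo - (j : Site 2)) (hi + (j : Site 2)) ℓs M x) ℓs R', Φ.φ v ∈ Finset.Icc (lo - (j : Site 2)) (hi + (j : Site 2)) := by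
    intro x hx v hv
    have h := (φ_cyl_deepCtr Φ hwide (hx' x hx) (cylBall_subset_cyl Φ _ ℓs R' hv)).1
    rw [Finset.mem_Icc, Pi.le_def, Pi.le_def]
    exact ⟨fun i => by have h1 := (h i).1; linarith, fun i => by have h2 := (h i).2; linarith⟩
  have hcyl_t : ∀ x ∈ K, ∀ v ∈ Φ.cylBall (deepCtr Φ w₀ R (lo - (j : Site 2)) (hi + (j : Site 2)) ℓs M x) ℓs R', v ∈ graphBall G (deepCtr Φ w₀ R (lo - (j : Site 2)) (hi + (j : Site 2)) ℓs M x) R' :=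
    fun x hx v hv => (Φ.cylBall_subset_prism _ ℓs R' hv).1
  -- `y ∈ B(x, 1)`
  have hy1 : ∀ x ∈ K, inNbr Φ w₀ R (Finset.Icc (lo - (j : Site 2)) (hi + (j : Site 2))) x ∈ graphBall G x 1 := fun x hx =>
    BoxProdZ2.mem_graphBall_succ_of_adj G (mem_graphBall_self G x 0) (hy x hx).1
  -- paths inside the near region
  have hpath : ∀ x ∈ K, ∀ v ∈ (insert (inNbr Φ w₀ R (Finset.Icc (lo - (j : Site 2)) (hi + (j : Site 2))) x) (pathFin Φ (lo - (j : Site 2)) (hi + (j : Site 2)) ℓs M (exitDir Φ w₀ R (lo - (j : Site 2)) (hi + (j : Site 2)) x).1 (inNbr Φ w₀ R (Finset.Icc (lo - (j : Site 2)) (hi + (j : Site 2))) x)) ∪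
      cylBallFin Φ (deepCtr Φ w₀ R (lo - (j : Site 2)) (hi + (j : Site 2)) ℓs M x) ℓs R' : Finset V),
      PathIn G (↑(insert (inNbr Φ w₀ R (Finset.Icc (lo - (j : Site 2)) (hi + (j : Site 2))) x) (pathFin Φ (lo - (j : Site 2)) (hi + (j : Site 2)) ℓs M (exitDir Φ w₀ R (lo - (j : Site 2)) (hi + (j : Site 2)) x).1 (inNbr Φ w₀ R (Finset.Icc (lo - (j : Site 2)) (hi + (j : Site 2))) x)) ∪
        cylBallFin Φ (deepCtr Φ w₀ R (lo - (j : Site 2)) (hi + (j : Site 2)) ℓs M x) ℓs R' : Finset V) : Set V) (inNbr Φ w₀ R (Finset.Icc (lo - (j : Site 2)) (hi + (j : Site 2))) x) v := by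
    intro x hx v hv
    set A : Finset V := insert (inNbr Φ w₀ R (Finset.Icc (lo - (j : Site 2)) (hi + (j : Site 2))) x) (pathFin Φ (lo - (j : Site 2)) (hi + (j : Site 2)) ℓs M (exitDir Φ w₀ R (lo - (j : Site 2)) (hi + (j : Site 2)) x).1 (inNbr Φ w₀ R (Finset.Icc (lo - (j : Site 2)) (hi + (j : Site 2))) x)) ∪
      cylBallFin Φ (deepCtr Φ w₀ R (lo - (j : Site 2)) (hi + (j : Site 2)) ℓs M x) ℓs R' with hA
    have hAy : inNbr Φ w₀ R (Finset.Icc (lo - (j : Site 2)) (hi + (j : Site 2))) x ∈ (↑A : Set V) := by simp [hA]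
    have hAp : ∀ k, k ≤ pathLen Φ (lo - (j : Site 2)) (hi + (j : Site 2)) ℓs M (exitDir Φ w₀ R (lo - (j : Site 2)) (hi + (j : Site 2)) x).1 (inNbr Φ w₀ R (Finset.Icc (lo - (j : Site 2)) (hi + (j : Site 2))) x) →
        pathPt Φ (lo - (j : Site 2)) (hi + (j : Site 2)) ℓs M (exitDir Φ w₀ R (lo - (j : Site 2)) (hi + (j : Site 2)) x).1 (inNbr Φ w₀ R (Finset.Icc (lo - (j : Site 2)) (hi + (j : Site 2))) x) k ∈ (↑A : Set V) := fun k hk => by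
      rw [Finset.mem_coe, hA, Finset.mem_union, Finset.mem_insert]; exact Or.inl (Or.inr (hpathFin_mem x hx k hk))
    have hAc : Φ.cylBall (deepCtr Φ w₀ R (lo - (j : Site 2)) (hi + (j : Site 2)) ℓs M x) ℓs R' ⊆ (↑A : Set V) := by
      intro u hu; rw [Finset.mem_coe, hA, Finset.mem_union]; exact Or.inr ((mem_cylBallFin Φ).2 hu)
    -- along the path
    have hP : ∀ k, k ≤ pathLen Φ (lo - (j : Site 2)) (hi + (j : Site 2)) ℓs M (exitDir Φ w₀ R (lo - (j : Site 2)) (hi + (j : Site 2)) x).1 (inNbr Φ w₀ R (Finset.Icc (lo - (j : Site 2)) (hi + (j : Site 2))) x) →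
        PathIn G (↑A : Set V) (inNbr Φ w₀ R (Finset.Icc (lo - (j : Site 2)) (hi + (j : Site 2))) x) (pathPt Φ (lo - (j : Site 2)) (hi + (j : Site 2)) ℓs M (exitDir Φ w₀ R (lo - (j : Site 2)) (hi + (j : Site 2)) x).1 (inNbr Φ w₀ R (Finset.Icc (lo - (j : Site 2)) (hi + (j : Site 2))) x) k) := by
      intro k hk
      induction k with
      | zero =>
        rcases (inward_spec Φ (exitDir Φ w₀ R (lo - (j : Site 2)) (hi + (j : Site 2)) x).1 (hw2 _) (hy x hx).2.2).1 with h | h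
        · have h0 : pathPt Φ (lo - (j : Site 2)) (hi + (j : Site 2)) ℓs M (exitDir Φ w₀ R (lo - (j : Site 2)) (hi + (j : Site 2)) x).1 (inNbr Φ w₀ R (Finset.Icc (lo - (j : Site 2)) (hi + (j : Site 2))) x) 0 = inNbr Φ w₀ R (Finset.Icc (lo - (j : Site 2)) (hi + (j : Site 2))) x := h
          rw [h0]; exact PathIn.refl hAy
        · exact PathIn.of_adj hAy (hAp 0 hk) h
      | succ k ih => exact (ih (by omega)).tail (pathPt_adj Φ _ _ ℓs M _ _ k) (hAp (k + 1) hk)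
    rw [hA, Finset.mem_union, Finset.mem_insert] at hv
    rcases hv with (rfl | hv) | hv
    · exact PathIn.refl hAy
    · obtain ⟨k, hk, rfl⟩ := hmem_pathFin x hx v hv
      exact hP k hk
    · exact (hP _ le_rfl).trans ((pathIn_cylBall' Φ (pathPt_last_mem_cylBall Φ hwide hR' (hx' x hx)) ((mem_cylBallFin Φ).1 hv)).mono hAc)
  refine ⟨fun x hx => (hy x hx).1, fun x hx => ?_, fun x hx => ?_, fun x hx => ?_, fun x hx => ?_, fun x hx => ?_, fun x hx => ?_,
    fun x hx => ?_, fun x hx => ?_, fun x hx => ?_⟩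
  · -- y_mem
    show inNbr Φ w₀ R (Finset.Icc (lo - (j : Site 2)) (hi + (j : Site 2))) x ∈ (slabGeomDeep Φ w₀ R lo hi j ℓs M R' r₀ Unear).S x
    simp only [slabGeomDeep]
    split_ifs with hnear
    · exact Finset.mem_union_left _ (Finset.mem_insert_self _ _)
    · exact Finset.mem_singleton_self _
  · -- S_sub
    show (slabGeomDeep Φ w₀ R lo hi j ℓs M R' r₀ Unear).S x ⊆ winLevel Φ w₀ R lo hi j
    simp only [slabGeomDeep]
    split_ifs with hnear
    · intro v hv
      rw [Finset.mem_union, Finset.mem_insert] at hv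
      rw [mem_winLevel_iff]
      rcases hv with (rfl | hv) | hv
      · exact ⟨(hy x hx).2.1, (hy x hx).2.2⟩
      · obtain ⟨k, hk, rfl⟩ := hmem_pathFin x hx v hv
        refine ⟨?_, hpbox x hx k hk⟩
        have h := BoxProdZ2.mem_graphBall_add G hnear (hpball x hx k)
        have := hKle x hx
        exact graphBall_mono G w₀ (by omega) h
      · refine ⟨?_, hcyl_box x hx v ((mem_cylBallFin Φ).1 hv)⟩
        have h := BoxProdZ2.mem_graphBall_add G (BoxProdZ2.mem_graphBall_add G hnear (ht x hx)) (hcyl_t x hx v ((mem_cylBallFin Φ).1 hv))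
        exact graphBall_mono G w₀ (by omega) h
    · intro v hv; rw [Finset.mem_singleton] at hv; rw [hv]
      exact (mem_winLevel_iff Φ).2 ⟨(hy x hx).2.1, (hy x hx).2.2⟩
  · -- U_sub
    show (slabGeomDeep Φ w₀ R lo hi j ℓs M R' r₀ Unear).U x ⊆ winLevel Φ w₀ R lo hi j
    simp only [slabGeomDeep]
    split_ifs with hnear
    · exact hU.sub x hx hnear
    · intro v hv; rw [Finset.mem_singleton] at hv; rw [hv]
      exact (mem_winLevel_iff Φ).2 ⟨(hy x hx).2.1, (hy x hx).2.2⟩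
  · -- S_ball
    show ∀ v ∈ (slabGeomDeep Φ w₀ R lo hi j ℓs M R' r₀ Unear).S x, v ∈ graphBall G x rs
    simp only [slabGeomDeep]
    split_ifs with hnear
    · intro v hv
      rw [Finset.mem_union, Finset.mem_insert] at hv
      rcases hv with (rfl | hv) | hv
      · exact graphBall_mono G x (by omega) (hy1 x hx)
      · obtain ⟨k, hk, rfl⟩ := hmem_pathFin x hx v hv
        have h := BoxProdZ2.mem_graphBall_add G (hy1 x hx) (hpball x hx k)
        have := hKle x hx
        exact graphBall_mono G x (by omega) h
      · have h := BoxProdZ2.mem_graphBall_add G (BoxProdZ2.mem_graphBall_add G (hy1 x hx) (ht x hx))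
          (hcyl_t x hx v ((mem_cylBallFin Φ).1 hv))
        exact graphBall_mono G x (by omega) h
    · intro v hv; rw [Finset.mem_singleton] at hv; rw [hv]; exact graphBall_mono G x (by omega) (hy1 x hx)
  · -- U_ball
    show ∀ u ∈ (slabGeomDeep Φ w₀ R lo hi j ℓs M R' r₀ Unear).U x, u ∈ graphBall G x rs
    simp only [slabGeomDeep]
    split_ifs with hnear
    · exact hU.ball x hx hnear
    · intro v hv; rw [Finset.mem_singleton] at hv; rw [hv]; exact graphBall_mono G x (by omega) (hy1 x hx)
  · -- S_path
    show ∀ v ∈ (slabGeomDeep Φ w₀ R lo hi j ℓs M R' r₀ Unear).S x,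
      PathIn G ↑((slabGeomDeep Φ w₀ R lo hi j ℓs M R' r₀ Unear).S x) ((slabGeomDeep Φ w₀ R lo hi j ℓs M R' r₀ Unear).y x) v
    simp only [slabGeomDeep]
    split_ifs with hnear
    · exact hpath x hx
    · intro v hv; rw [Finset.mem_singleton] at hv; rw [hv, Finset.coe_singleton]
      exact PathIn.refl (Set.mem_singleton _)
  · -- U_adj
    show ∀ u ∈ (slabGeomDeep Φ w₀ R lo hi j ℓs M R' r₀ Unear).U x, u ∈ (slabGeomDeep Φ w₀ R lo hi j ℓs M R' r₀ Unear).S x ∨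
      ∃ v ∈ (slabGeomDeep Φ w₀ R lo hi j ℓs M R' r₀ Unear).S x, G.Adj v u
    simp only [slabGeomDeep]
    split_ifs with hnear
    · intro u hu
      obtain ⟨v, hv, hvu⟩ := hU.adj x hx hnear u hu
      exact Or.inr ⟨v, Finset.mem_union_right _ ((mem_cylBallFin Φ).2 hv), hvu⟩
    · intro u hu; exact Or.inl hu
  · -- S_card
    show ((slabGeomDeep Φ w₀ R lo hi j ℓs M R' r₀ Unear).S x).card ≤ (Φ.Δ + 1) ^ R' + (tanOff ℓs M + 2)
    simp only [slabGeomDeep]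
    split_ifs with hnear
    · have hp : (insert (inNbr Φ w₀ R (Finset.Icc (lo - (j : Site 2)) (hi + (j : Site 2))) x) (pathFin Φ (lo - (j : Site 2)) (hi + (j : Site 2)) ℓs M (exitDir Φ w₀ R (lo - (j : Site 2)) (hi + (j : Site 2)) x).1 (inNbr Φ w₀ R (Finset.Icc (lo - (j : Site 2)) (hi + (j : Site 2))) x))).card ≤ tanOff ℓs M + 2 := by
        refine (Finset.card_insert_le _ _).trans ?_
        unfold pathFin
        refine (Nat.add_le_add_right Finset.card_image_le 1).trans ?_
        rw [Finset.card_range]; have := hKle x hx; omega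
      calc (insert (inNbr Φ w₀ R (Finset.Icc (lo - (j : Site 2)) (hi + (j : Site 2))) x) (pathFin Φ (lo - (j : Site 2)) (hi + (j : Site 2)) ℓs M (exitDir Φ w₀ R (lo - (j : Site 2)) (hi + (j : Site 2)) x).1 (inNbr Φ w₀ R (Finset.Icc (lo - (j : Site 2)) (hi + (j : Site 2))) x)) ∪
              cylBallFin Φ (deepCtr Φ w₀ R (lo - (j : Site 2)) (hi + (j : Site 2)) ℓs M x) ℓs R').card
          ≤ (insert (inNbr Φ w₀ R (Finset.Icc (lo - (j : Site 2)) (hi + (j : Site 2))) x) (pathFin Φ (lo - (j : Site 2)) (hi + (j : Site 2)) ℓs M (exitDir Φ w₀ R (lo - (j : Site 2)) (hi + (j : Site 2)) x).1 (inNbr Φ w₀ R (Finset.Icc (lo - (j : Site 2)) (hi + (j : Site 2))) x))).card +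
              (cylBallFin Φ (deepCtr Φ w₀ R (lo - (j : Site 2)) (hi + (j : Site 2)) ℓs M x) ℓs R').card := Finset.card_union_le _ _
        _ ≤ (tanOff ℓs M + 2) + (Φ.Δ + 1) ^ R' := Nat.add_le_add hp (card_cylBallFin_le Φ _ ℓs R')
        _ = (Φ.Δ + 1) ^ R' + (tanOff ℓs M + 2) := Nat.add_comm _ _
    · rw [Finset.card_singleton]; omega
  · -- U_card
    show ((slabGeomDeep Φ w₀ R lo hi j ℓs M R' r₀ Unear).U x).card ≤ cU
    simp only [slabGeomDeep]
    split_ifs with hnear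
    · exact hU.card x hx hnear
    · rw [Finset.card_singleton]; exact hU.one_le

end SkelI

end Transplant

end Summit.CriticalPhenomena.PercolationContinuityZ3.Theorems

end
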